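import Summits.BirchSwinnertonDyer.Rank1Residual.Additive.X3BranchLayerTwoTIndependence
import Summits.BirchSwinnertonDyer.Rank1Residual.Additive.X3BranchLayerTwoTClassFull
import Summits.BirchSwinnertonDyer.Rank1Residual.Additive.X3BranchResidualLineH1LayerLowerBound
import HarnessLib

/-!
# X3, the DEGENERATE rows OFF the sub-locus: the T-side LOWER BOUND `3^{#T + #J} ≤ #H¹(ℚ_Σ/ℚ_∞, Φ₀)`
# with the SECOND-LAYER classes — conductor-`ℓ` characters (`ℓ ∈ T`, `ℓ ≡ 1 (mod 3)`, gen 6) AND the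
# twisted Kummer classes over `ℚ_2` (`j ∈ J`: nine per `ℓ ≡ 1 (mod 27)`, three per `ℓ ≡ 1 (mod 9)` —
# radicands in `ℤ[ζ₂₇]`) (cell `bsd-eis`, seat `bsd-eis-x3` gen 8; the file
# `X3BranchResidualLineH1LayerLowerBound.lean` one level up; x3-MEMO-10 §5 (f); route K1
# `AdditiveBranchIMC`, crux `GordTwoRankZeroOffCaseOne` — supports only)

HONEST FRAMING (`run/shared/lean/pub/bsd-eis/README.md` §4): THEOREMS ONLY (no `def`, no named fact,
no `sorry`); nothing is booked; no label, tier or count of record moves.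

## What

`X3Branch.pow_card_le_natCard_residualLineH1_of_trivialLine_layerTwo`: for the cyclotomic `κ`,
`Σ₀ ∌ 3`, a rational line `Φ₀` fixed pointwise, a set `T` of primes `ℓ ≡ 1 (mod 3)` under `Σ₀`, and a
family `J` of second-layer T-side data (`bⱼ, b'ⱼ ∈ ℤ¹⁸` on the basis `ζ₂₇^k`, `Eⱼ ∈ ℤ⁹` on the basis
`θ₂^a`, `nⱼ ≠ 0` with places in `Σ₀`, `bⱼ(ζ)b'ⱼ(ζ) = nⱼ`, `bⱼ(ζ²⁶)bⱼ(ζ) = Eⱼ(θ₂)³`, no `ℓ ∈ T` dividing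
any `nⱼ`) together with the cubic-residue certificate of STEP 4 (primes `q ≡ 1 (mod 81)`):
`3^{#T + #J} ≤ #H¹(ℚ_Σ/ℚ_∞, Φ₀)`. PROOF: word for word the first-layer file with
`KummerLayerTwisted.exists_layerTwoTClass_full` and `KummerLayerTwisted.eq_zero_of_layerTwoT_dependency`.
References: [GreenbergVatsal2000] §2 pp. 28–30; [Washington1997] Prop. 2.3, §13.1;
[SerreLocalFields1979] Ch. X §3; [IrelandRosen1990] Ch. 9 §1.
-/

set_option autoImplicit false

noncomputable section

open scoped Classical AddSubgroup

namespace Summit.BirchSwinnertonDyer.Rank1Residual.Additive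

open Field Polynomial NumberField IsDedekindDomain WeierstrassCurve
  Literature.NumberTheory.GaloisRepresentations
  Literature.NumberTheory.EllipticCurves
  Literature.NumberTheory.EllipticCurves.GreenbergSelmer
  Literature.NumberTheory.EllipticCurves.GreenbergVatsal2000
  Literature.NumberTheory.EllipticCurves.Rank1Residual
  TrivialLineClasses KummerLayerTwisted

variable {W : WeierstrassCurve ℚ}

/-- **T-side LOWER BOUND with the second-layer classes.** See the module docstring.
[cite: GreenbergVatsal2000, §2 pp. 28–30] [cite: Washington1997, Prop. 2.3, §13.1]
[cite: SerreLocalFields1979, Ch. X §3] [cite: IrelandRosen1990, Ch. 9 §1] -/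
theorem X3Branch.pow_card_le_natCard_residualLineH1_of_trivialLine_layerTwo [hp : Fact (Nat.Prime 3)]
    (κ : ZpExtension ℚ 3) (hκ : κ.IsCyclotomic) (S₀ : Finset (HeightOneSpectrum (𝓞 ℚ)))
    (hS₀ : ∀ v ∈ S₀, ((3 : ℕ) : 𝓞 ℚ) ∉ v.asIdeal)
    {Φ₀ : AddSubgroup (W.geomTorsion ((3 : ℕ) : ℤ))} (hΦ : IsRationalLine W 3 Φ₀)
    (htriv : ∀ (σ : absoluteGaloisGroup ℚ) (Pt : geomTorsion W ((3 : ℕ) : ℤ)), Pt ∈ Φ₀ → σ • Pt = Pt)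
    (T : Finset ℕ) (hT : ∀ ℓ ∈ T, ℓ.Prime ∧ 3 ∣ ℓ - 1 ∧ ∃ v ∈ S₀, ((ℓ : ℕ) : 𝓞 ℚ) ∈ v.asIdeal)
    {ζ : AlgebraicClosure ℚ} (hζ : IsPrimitiveRoot ζ 27)
    {J : Type} [Fintype J] [DecidableEq J]
    (b b' : J → Fin 18 → ℤ) (E : J → Fin 9 → ℤ) (n : J → ℕ) (hn0 : ∀ j, n j ≠ 0)
    (hn : ∀ j, (∑ k : Fin 18, (b j k : AlgebraicClosure ℚ) * ζ ^ (k : ℕ)) *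
      (∑ k : Fin 18, (b' j k : AlgebraicClosure ℚ) * ζ ^ (k : ℕ)) = (n j : AlgebraicClosure ℚ))
    (hnS : ∀ j (v : HeightOneSpectrum (𝓞 ℚ)), ((n j : ℕ) : 𝓞 ℚ) ∈ v.asIdeal → v ∈ S₀)
    (hflip : ∀ j, (∑ k : Fin 18, (b j k : AlgebraicClosure ℚ) * (ζ ^ 26) ^ (k : ℕ)) *
      (∑ k : Fin 18, (b j k : AlgebraicClosure ℚ) * ζ ^ (k : ℕ)) =
      (∑ a : Fin 9, (E j a : AlgebraicClosure ℚ) * (ζ + ζ ^ 26) ^ (a : ℕ)) ^ 3)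
    (hTn : ∀ ℓ ∈ T, ∀ j, ¬ ℓ ∣ n j)
    -- the cubic-residue certificate (STEP 4)
    {R : ℕ} (q : Fin R → ℕ) (hq : ∀ ρ, (q ρ).Prime) (hq81 : ∀ ρ, 81 ∣ q ρ - 1)
    (r : (ρ : Fin R) → Fin 18 → ZMod (q ρ)) (hr : ∀ ρ k, r ρ k ^ 18 + r ρ k ^ 9 + 1 = 0)
    (w : (ρ : Fin R) → Fin 18 → Fin 18 → ZMod (q ρ))
    (hw : ∀ ρ (a a' : Fin 18), ∑ k, w ρ a k * r ρ k ^ a'.val = if a = a' then 1 else 0)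
    (ω : (ρ : Fin R) → ZMod (q ρ)) (hω : ∀ ρ, ω ρ ^ 3 = 1 ∧ ω ρ ≠ 1)
    (e : Fin R → J → ℕ)
    (he : ∀ ρ j, (∑ k : Fin 18, (b j k : ZMod (q ρ)) * r ρ 0 ^ (k : ℕ)) ^ ((q ρ - 1) / 3) =
      ω ρ ^ e ρ j)
    (hnz : ∀ ρ j, (∑ k : Fin 18, (b j k : ZMod (q ρ)) * r ρ 0 ^ (k : ℕ)) ≠ 0)
    (L : J → Fin R → ℤ)
    (hL : ∀ j j', (∑ ρ, (L j ρ : ZMod 3) * (e ρ j' : ZMod 3)) = if j = j' then 1 else 0)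
    [Finite (residualLineH1 W 3 κ S₀ Φ₀ hΦ)] :
    3 ^ (T.card + Fintype.card J) ≤ Nat.card (residualLineH1 W 3 κ S₀ Φ₀ hΦ) := by
  have htrivΦ := residualLine_smul_eq_self hΦ htriv
  have htrivH := subgroup_smul_eq_self_of_trivial κ.kerSubgroup htrivΦ
  obtain ⟨x₀, hx₀⟩ := exists_addOrderOf_eq_residualLine (p := 3) (W := W) hΦ
  have hx₀' : 3 • x₀ = 0 := by
    have h := addOrderOf_nsmul_eq_zero x₀
    rwa [hx₀] at h
  /- ### the conductor-`ℓ` classes (gen 6) -/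
  choose vOf hvOfS hvOf using fun ℓ : T ↦ (hT ℓ ℓ.2).2.2
  have huniq : ∀ (ℓ : ℕ), ℓ.Prime → ∀ v v' : HeightOneSpectrum (𝓞 ℚ),
      ((ℓ : ℕ) : 𝓞 ℚ) ∈ v.asIdeal → ((ℓ : ℕ) : 𝓞 ℚ) ∈ v'.asIdeal → v = v' := fun ℓ hℓ v v' hv hv' ↦ by
    have h1 := (Literature.NumberTheory.Automorphic.BCDT.natCast_mem_asIdeal_iff_primesEquiv_eq v hℓ).mp hv
    have h2 := (Literature.NumberTheory.Automorphic.BCDT.natCast_mem_asIdeal_iff_primesEquiv_eq v' hℓ).mp hv'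
    exact Rat.HeightOneSpectrum.primesEquiv.injective (Subtype.ext (h1.trans h2.symm))
  choose χT hχTadd hχTcont hχTunr τ hτI hχTτ using fun ℓ : T ↦
    exists_addChar_cyclotomic_sub (p := 3) (Φ := (residualLine Φ₀ hΦ).Sub) ℓ.1 (hT ℓ ℓ.2).1
      (hT ℓ ℓ.2).2.1 x₀ hx₀ (vOf ℓ) (hvOf ℓ)
  choose cT hcT using fun ℓ : T ↦
    exists_class_of_addChar κ.kerSubgroup htrivΦ (χT ℓ) (hχTadd ℓ) (hχTcont ℓ)
  have hτH : ∀ ℓ : T, τ ℓ ∈ κ.kerSubgroup := fun ℓ ↦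
    X2.GreenbergVatsalUnramifiedAway.inertia_le_kerSubgroup_of_isCyclotomic κ (vOf ℓ) hκ
      (hS₀ _ (hvOfS ℓ)) (hτI ℓ)
  -- `χ_{ℓ'}(τ_ℓ) = 0` for `ℓ' ≠ ℓ`, `= x₀` for `ℓ' = ℓ`
  have hχTτ' : ∀ ℓ ℓ' : T, ℓ' ≠ ℓ → χT ℓ' (τ ℓ) = 0 := by
    intro ℓ ℓ' hne
    refine hχTunr ℓ' (vOf ℓ) (fun hmem ↦ hne (Subtype.ext ?_)) (τ ℓ) (hτI ℓ)
    have h1 := (Literature.NumberTheory.Automorphic.BCDT.natCast_mem_asIdeal_iff_primesEquiv_eq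
      (vOf ℓ) (hT ℓ ℓ.2).1).mp (hvOf ℓ)
    have h2 := (Literature.NumberTheory.Automorphic.BCDT.natCast_mem_asIdeal_iff_primesEquiv_eq
      (vOf ℓ) (hT ℓ' ℓ'.2).1).mp hmem
    exact h2.symm.trans h1
  -- no `ℓ ∈ T` divides an `n_j`: `n_j ∉ v_ℓ`
  have hnv : ∀ (ℓ : T) (j : J), ((n j : ℕ) : 𝓞 ℚ) ∉ (vOf ℓ).asIdeal := by
    intro ℓ j hmem
    have hgen : Rat.HeightOneSpectrum.natGenerator (vOf ℓ) = ℓ :=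
      (Literature.NumberTheory.Automorphic.BCDT.natCast_mem_asIdeal_iff_primesEquiv_eq (vOf ℓ)
        (hT ℓ ℓ.2).1).mp (hvOf ℓ)
    refine hTn ℓ ℓ.2 j ?_
    rw [← hgen, Rat.HeightOneSpectrum.natGenerator_dvd_iff]
    have h := Ideal.mem_map_of_mem (Rat.IsIntegralClosure.intEquiv (𝓞 ℚ)) hmem
    rwa [map_natCast] at h
  /- ### the layer classes (gens 7–8) -/
  set Bp : J → ℤ[X] := fun j ↦ ∑ k : Fin 18, C (b j k) * X ^ (k : ℕ) with hBp
  set Bp' : J → ℤ[X] := fun j ↦ ∑ k : Fin 18, C (b' j k) * X ^ (k : ℕ) with hBp'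
  set Ep : J → ℤ[X] := fun j ↦ ∑ a : Fin 9, C (E j a) * X ^ (a : ℕ) with hEp
  have hB : ∀ j (x : AlgebraicClosure ℚ), aeval x (Bp j) =
      ∑ k : Fin 18, (b j k : AlgebraicClosure ℚ) * x ^ (k : ℕ) := fun j x ↦ by
    simp only [hBp, map_sum, map_mul, map_pow, aeval_C, aeval_X]
    simp only [eq_intCast]
  have hB' : ∀ j, aeval ζ (Bp' j) = ∑ k : Fin 18, (b' j k : AlgebraicClosure ℚ) * ζ ^ (k : ℕ) :=
    fun j ↦ by
    simp only [hBp', map_sum, map_mul, map_pow, aeval_C, aeval_X]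
    simp only [eq_intCast]
  have hE : ∀ j, aeval (ζ + ζ ^ 26) (Ep j) =
      ∑ a : Fin 9, (E j a : AlgebraicClosure ℚ) * (ζ + ζ ^ 26) ^ (a : ℕ) := fun j ↦ by
    simp only [hEp, map_sum, map_mul, map_pow, aeval_C, aeval_X]
    simp only [eq_intCast]
  have hnA : ∀ j, aeval ζ (Bp j) * aeval ζ (Bp' j) = (n j : AlgebraicClosure ℚ) := fun j ↦ by
    rw [hB, hB']; exact hn j
  have hflipA : ∀ j, aeval (ζ ^ 26) (Bp j) * aeval ζ (Bp j) = aeval (ζ + ζ ^ 26) (Ep j) ^ 3 :=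
    fun j ↦ by rw [hB, hB, hE]; exact hflip j
  choose β hβ using fun j ↦ IsAlgClosed.exists_pow_nat_eq (aeval ζ (Bp j)) (by norm_num : 0 < 3)
  have hβ' : ∀ j, β j ^ 3 = ∑ k : Fin 18, (b j k : AlgebraicClosure ℚ) * ζ ^ (k : ℕ) := fun j ↦ by
    rw [hβ j, hB]
  choose χJ cJ hcJmem hcJ hχJlc hχJadd hχJ₁ hχJ₂ hχJinert using fun j ↦
    exists_layerTwoTClass_full κ hκ S₀ hΦ htriv x₀ hx₀' hζ (Bp j) (Bp' j) (Ep j) (hn0 j) (hnA j)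
      (hnS j) (hflipA j) (hβ j)
  -- the layer characters vanish at the test elements `τ_ℓ`
  have hχJτ : ∀ (ℓ : T) (j : J), χJ j (τ ℓ) = 0 := fun ℓ j ↦
    hχJinert j (vOf ℓ) (hS₀ _ (hvOfS ℓ)) (hnv ℓ j) (τ ℓ) (hτI ℓ)
  /- ### counting -/
  refine le_of_eq_of_le (by rw [Fintype.card_sum, Fintype.card_coe])
    (pow_card_le_natCard_of_classes_of_injective κ.kerSubgroup htrivH (p := 3)
      (residualLineH1 W 3 κ S₀ Φ₀ hΦ) (ι := T ⊕ J) (Sum.elim cT cJ) ?_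
      (Sum.elim (fun (ℓ : T) (h : κ.kerSubgroup) ↦ χT ℓ h)
        (fun (j : J) (h : κ.kerSubgroup) ↦ (χJ j h).val • x₀)) ?_ ?_)
  · -- membership
    rintro (ℓ | j)
    · simp only [Sum.elim_inl]
      refine mem_unramifiedOutside_of_addChar κ.kerSubgroup htrivΦ (χT ℓ) (hχTadd ℓ) (cT ℓ) (hcT ℓ)
        3 (↑S₀) fun v hvS _ ↦ hχTunr ℓ v fun hv ↦ hvS ?_
      rw [huniq ℓ.1 (hT ℓ ℓ.2).1 v (vOf ℓ) hv (hvOf ℓ)]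
      exact hvOfS ℓ
    · simp only [Sum.elim_inr]
      exact hcJmem j
  · -- cocycles
    rintro (ℓ | j) h
    · simp only [Sum.elim_inl]; exact hcT ℓ h
    · simp only [Sum.elim_inr]; exact hcJ j h
  · -- independence
    intro k k' heq
    -- (a) the `T`-coordinates: test at `τ_ℓ`
    have hTsum : ∀ (kk : T ⊕ J → ZMod 3) (ℓ : T),
        (∑ i, (kk i).val • Sum.elim (fun (ℓ : T) (h : κ.kerSubgroup) ↦ χT ℓ h)
          (fun (j : J) (h : κ.kerSubgroup) ↦ (χJ j h).val • x₀) i ⟨τ ℓ, hτH ℓ⟩) =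
          (kk (Sum.inl ℓ)).val • x₀ := by
      intro kk ℓ
      rw [Fintype.sum_sum_type]
      simp only [Sum.elim_inl, Sum.elim_inr]
      have h1 : (∑ ℓ' : T, (kk (Sum.inl ℓ')).val • χT ℓ' (τ ℓ)) = (kk (Sum.inl ℓ)).val • x₀ := by
        rw [Finset.sum_eq_single ℓ]
        · rw [hχTτ ℓ]
        · intro ℓ' _ hne; rw [hχTτ' ℓ ℓ' hne, smul_zero]
        · intro h; exact absurd (Finset.mem_univ ℓ) h
      have h2 : (∑ j : J, (kk (Sum.inr j)).val • ((χJ j (τ ℓ)).val • x₀)) = 0 :=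
        Finset.sum_eq_zero fun j _ ↦ by rw [hχJτ ℓ j, ZMod.val_zero, zero_nsmul, smul_zero]
      rw [h1, h2, add_zero]
    have hT_eq : ∀ ℓ : T, k (Sum.inl ℓ) = k' (Sum.inl ℓ) := by
      intro ℓ
      have h := heq ⟨τ ℓ, hτH ℓ⟩
      rw [hTsum k ℓ, hTsum k' ℓ, nsmul_inj_mod, hx₀] at h
      apply ZMod.val_injective
      have h1 : (k (Sum.inl ℓ)).val < 3 := ZMod.val_lt _
      have h2 : (k' (Sum.inl ℓ)).val < 3 := ZMod.val_lt _
      rw [Nat.mod_eq_of_lt h1, Nat.mod_eq_of_lt h2] at h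
      exact h
    -- (b) the `J`-coordinates: a dependency among the layer characters
    have heqJ : ∀ h ∈ κ.kerSubgroup,
        (∑ j, (k (Sum.inr j)).val • ((χJ j h).val • x₀)) =
          ∑ j, (k' (Sum.inr j)).val • ((χJ j h).val • x₀) := by
      intro h hh
      have h1 := heq ⟨h, hh⟩
      rw [Fintype.sum_sum_type, Fintype.sum_sum_type] at h1
      simp only [Sum.elim_inl, Sum.elim_inr] at h1
      have hTpart : (∑ ℓ : T, (k (Sum.inl ℓ)).val • χT ℓ h) = ∑ ℓ : T, (k' (Sum.inl ℓ)).val • χT ℓ h :=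
        Finset.sum_congr rfl fun ℓ _ ↦ by rw [hT_eq ℓ]
      rw [hTpart] at h1
      exact add_left_cancel h1
    obtain ⟨hlc', hadd', hker'⟩ := LayerCharTower.dependency_char (κ.layerSubgroup 2) κ.kerSubgroup
      χJ hχJlc hχJadd x₀ hx₀ (fun j ↦ k (Sum.inr j)) (fun j ↦ k' (Sum.inr j)) heqJ
    have hd := eq_zero_of_layerTwoT_dependency hκ hζ b β hβ' χJ hχJ₁
      (fun j ↦ k (Sum.inr j) - k' (Sum.inr j)) hlc' hadd' hker' q hq hq81 r hr w hw ω hω e he hnz L hL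
    funext i
    rcases i with ℓ | j
    · exact hT_eq ℓ
    · exact sub_eq_zero.mp (congrFun hd j)

end Summit.BirchSwinnertonDyer.Rank1Residual.Additive

end
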